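import Summits.KontsevichZagierPeriods.KontsevichZagierPeriods.Theorems.LinRedNormalFormArrangementNormalFormStubRebaseSimpleZeroTwoPatterns

/-!
# Stub `stub_rebaseSimpleZeroTwo`, assembly (crux `ArrangementNormalForm`, line `janus-bands`) — part `TwoDifferent`

The stub `stub_rebaseSimpleZeroTwo` (rebase of the literal class `GS 0 2`: one base coordinate
`y` with a simple pole, two fibres) CONDITIONALLY on the different-slope hypothesis `HDiff`
(worker W8): a clean nest `A(y) < tᵢ < tⱼ < B(y)` BOTH of whose fibres are lettered, with letters
of DIFFERENT `y`-slopes, is congruent modulo `KZ.relations` to the subgroup generated by the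
rebased class (`GG 0 2 2`, NARROW form) resp. by the stub's own target
`GG 0 2 2 ∪ JJ 0 3 ∪ JD 2` (WIDE form).
* `RebaseNest.exists_diff_of_not_common` — letters without a common `y`-slope: both fibres are
  lettered and the two slopes differ;
* `RebaseNest.clean_of_diff` — the clean-nest hypothesis of `rebaseSimpleZeroTwo_of_clean` for a
  target `S ⊇ GG 0 2 2` from `HDiff` with target `S`: clean nests with letters of a common slope
  are the landed `rebaseSimpleZero_nestedCommonMain` (worker W3), the others are `HDiff`;
* `rebaseSimpleZeroTwo_of_differentGGset` (registered; literal binders, NARROW `HDiff`, target the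
  literal rebased class), `rebaseSimpleZeroTwo_of_different'` (NARROW `HDiff`) and
  `rebaseSimpleZeroTwo_of_differentWide'` (WIDE `HDiff`) in the stub's format (the stub's binders
  and conclusion): by `rebaseSimpleZeroTwo_of_clean` (product fibres `RebaseZero.good_literal`,
  pattern normalisation, clean nests) and the embedding `GG 0 2 2 ⊆ GG 0 2 2 ∪ JJ 0 3 ∪ JD 2`.

References: M. Kontsevich, D. Zagier, *Periods* (2001), §1.2, rules (1a), (1b), (2).
-/

noncomputable section

open Set MeasureTheory MvPolynomial
open Literature.NumberTheory.Transcendental Literature.ModelTheory.ExponentialFields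

namespace Summit.KontsevichZagierPeriods.ArrangementNormalForm.JanusBands

namespace RebaseNest

open SeparatePos RebasePos RebaseZero

variable {S : Set KZ.FormalRep} {i j : Fin 2}

/-- **Letters without a common `y`-slope**: if the letters of the two fibres `i ≠ j` admit no
common `y`-slope, both fibres are lettered and the two slopes differ. [folklore] -/
theorem exists_diff_of_not_common (hij : i ≠ j) (a : Fin 2 → Option Cf)
    (h : ¬ ∃ lam : ℚ, ∀ l c, a l = some c → c.1 (Fin.last 0) = lam) :
    ∃ ci cj, a i = some ci ∧ a j = some cj ∧ ci.1 (Fin.last 0) ≠ cj.1 (Fin.last 0) := by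
  by_contra hne
  refine h ?_
  rcases hai : a i with _ | ci
  · rcases haj : a j with _ | cj
    · refine ⟨0, fun l c hc => ?_⟩
      rcases (fin_two_eq_or hij l).imp Eq.symm Eq.symm with rfl | rfl
      · rw [hai] at hc; cases hc
      · rw [haj] at hc; cases hc
    · refine ⟨cj.1 (Fin.last 0), fun l c hc => ?_⟩
      rcases (fin_two_eq_or hij l).imp Eq.symm Eq.symm with rfl | rfl
      · rw [hai] at hc; cases hc
      · rw [haj] at hc; cases hc; rfl
  · refine ⟨ci.1 (Fin.last 0), fun l c hc => ?_⟩
    rcases (fin_two_eq_or hij l).imp Eq.symm Eq.symm with rfl | rfl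
    · rw [hai] at hc; cases hc; rfl
    · by_contra hcj
      exact hne ⟨ci, c, hai, hc, fun h' => hcj h'.symm⟩

/-- **The clean-nest hypothesis from the different-slope hypothesis.** For a target
`S ⊇ GG 0 2 2`: a clean nest whose letters have a common `y`-slope is good for `GG 0 2 2` by the
landed `rebaseSimpleZero_nestedCommonMain` (joint shear, dissection of the base interval,
pinch-vertex blow-up); otherwise both fibres are lettered with different slopes
(`exists_diff_of_not_common`) and the different-slope hypothesis `hD` (target `S`) applies.
[Kontsevich–Zagier 2001, §1.2, rules (1), (2)] -/
theorem clean_of_diff (hS : GGset 0 2 2 ⊆ S)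
    (hD : ∀ (m m' : ℕ) (s : KZ.IntegralRep (0 + 1 + 2)) (M : Fin m' → (Fin (0 + 1) → ℚ) × ℚ)
      (L : Fin m → (Fin 0 → ℚ) × ℚ) (e : Fin m → ℕ) (p : MvPolynomial (Fin 0) ℚ) (ℓ₁ ℓ₂ : (Fin 0 → ℚ) × ℚ)
      (a : Fin 2 → Option ((Fin (0 + 1) → ℚ) × ℚ)) (lo hi : Fin 2 → Fin 2 ⊕ ((Fin (0 + 1) → ℚ) × ℚ)) (i j : Fin 2)
      (A B ci cj : (Fin (0 + 1) → ℚ) × ℚ),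
      i ≠ j → lo i = Sum.inr A → hi i = Sum.inl j → lo j = Sum.inl i → hi j = Sum.inr B →
      a i = some ci → a j = some cj → ci.1 (Fin.last 0) ≠ cj.1 (Fin.last 0) →
      Bornology.IsBounded s.domain → s.domain = gDom 0 2 m' M lo hi →
      EqOn s.integrand (glit 0 2 p L e ℓ₁ ℓ₂ 0 1 a) s.domain →
      ∃ c ∈ AddSubgroup.closure S, KZ.of s - c ∈ KZ.relations)
    (m m₁ : ℕ) (r : KZ.IntegralRep (0 + 1 + 2)) (M₁ : Fin m₁ → Cf) (L : Fin m → (Fin 0 → ℚ) × ℚ)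
    (e : Fin m → ℕ) (p : MvPolynomial (Fin 0) ℚ) (ℓ₁ ℓ₂ : (Fin 0 → ℚ) × ℚ) (a : Fin 2 → Option Cf) (i j : Fin 2)
    (A Bd : Cf) (hij : i ≠ j) (hbd : Bornology.IsBounded r.domain)
    (hdom : r.domain = gDom 0 2 m₁ M₁ (nlo i A) (nhi j Bd))
    (hint : EqOn r.integrand (glit 0 2 p L e ℓ₁ ℓ₂ 0 1 a) r.domain) :
    ∃ c ∈ AddSubgroup.closure S, KZ.of r - c ∈ KZ.relations := by
  by_cases hlam : ∃ lam : ℚ, ∀ l c, a l = some c → c.1 (Fin.last 0) = lam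
  · exact goodS_of_good hS (rebaseSimpleZero_nestedCommonMain m m₁ 0 1 r M₁ L e p ℓ₁ ℓ₂ a (nlo i A) (nhi j Bd)
      (Or.inl rfl) rfl hbd hdom hint ⟨i, j, hij, Or.inl (nhi_of_ne hij Bd)⟩ hlam)
  · obtain ⟨ci, cj, hai, haj, hne⟩ := exists_diff_of_not_common hij a hlam
    exact hD m m₁ r M₁ L e p ℓ₁ ℓ₂ a (nlo i A) (nhi j Bd) i j A Bd ci cj hij (nlo_self i A) (nhi_of_ne hij Bd)
      (nlo_of_ne hij A) (nhi_self j Bd) hai haj hne hbd hdom hint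

end RebaseNest

/-- **The two-fibre rebase on the literal class, conditionally on the NARROW different-slope
hypothesis `HDiff`** (registered part of `stub_rebaseSimpleZeroTwo`, line `janus-bands`, literal
binders). A representation with a literal `GS 0 2` datum (one base coordinate `y` in a bounded
rational cell, base factor `p/∏ Lⱼ^{eⱼ} · (y − ℓ₁)^{n₁}/(y − ℓ₂)^{n₂}` with `n₂ = 1`, hence
`n₁ = 0`, two fibres `t₀, t₁` with optional letters `1/(tᵢ − cᵢ(y))`, bounds affine in `y` or
mutual) is congruent modulo `KZ.relations` to a `ℤ`-combination of elements of the rebased literal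
class `SeparatePos.GGset 0 2 2` (constant letters, bounds constant or exactly `y`), PROVIDED every
clean nest `A(y) < tᵢ < tⱼ < B(y)` both of whose fibres carry letters of DIFFERENT `y`-slopes is
good for the same class (`HDiff`, worker W8). Proof: `rebaseSimpleZeroTwo_of_clean` (product fibres, pattern
normalisation) with the clean-nest hypothesis `RebaseNest.clean_of_diff` (common slope: the landed
`rebaseSimpleZero_nestedCommonMain`; different slopes: `HDiff`).
[Kontsevich–Zagier 2001, §1.2, rules (1a), (1b), (2)] -/
theorem rebaseSimpleZeroTwo_of_differentGGset (HDiff : ∀ (m m' : ℕ) (s : KZ.IntegralRep (0 + 1 + 2)) (M : Fin m' → (Fin (0 + 1) → ℚ) × ℚ) (L : Fin m → (Fin 0 → ℚ) × ℚ) (e : Fin m → ℕ) (p : MvPolynomial (Fin 0) ℚ) (ℓ₁ ℓ₂ : (Fin 0 → ℚ) × ℚ) (a : Fin 2 → Option ((Fin (0 + 1) → ℚ) × ℚ)) (lo hi : Fin 2 → Fin 2 ⊕ ((Fin (0 + 1) → ℚ) × ℚ)) (i j : Fin 2) (A B ci cj : (Fin (0 + 1) → ℚ) × ℚ), i ≠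 j → lo i = Sum.inr A → hi i = Sum.inl j → lo j = Sum.inl i → hi j = Sum.inr B → a i = some ci → a j = some cj → ci.1 (Fin.last 0) ≠ cj.1 (Fin.last 0) → Bornology.IsBounded s.domain → s.domain = SeparatePos.gDom 0 2 m' M lo hi → EqOn s.integrand (RebasePos.glit 0 2 p L e ℓ₁ ℓ₂ 0 1 a) s.domain → ∃ c ∈ AddSubgroup.closure (SeparatePos.GGset 0 2 2), KZ.of s - c ∈ KZ.relations) (m m' n₁ n₂ : ℕ) (s : KZ.IntegralRep (0 + 1 + 2)) (M : Fin m' → (Fin (0 + 1) → ℚ) × ℚ) (L : Fin m → (Fin 0 → ℚ) × ℚ) (e : Fin m → ℕ) (p : MvPolynomial (Fin 0) ℚ) (ℓ₁ ℓ₂ : (Fin 0 → ℚ) × ℚ) (a : Fin 2 → Option ((Fin (0 + 1) → ℚ) × ℚ)) (lo hi : Fin 2 → Fin 2 ⊕ ((Fin (0 + 1) → ℚ) × ℚ)) (h12 : n₁ = 0 ∨ n₂ = 0) (hn : n₂ = 1) (hbd : Bornology.IsBounded s.domain) (hdom : s.domain = SeparatePos.gDom 0 2 m' M lo hi) (hint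 : EqOn s.integrand (RebasePos.glit 0 2 p L e ℓ₁ ℓ₂ n₁ n₂ a) s.domain) : ∃ c ∈ AddSubgroup.closure (SeparatePos.GGset 0 2 2), KZ.of s - c ∈ KZ.relations := by
  subst hn
  obtain rfl : n₁ = 0 := h12.resolve_right one_ne_zero
  exact rebaseSimpleZeroTwo_of_clean (SeparatePos.GGset 0 2 2) Subset.rfl
    (RebaseNest.clean_of_diff Subset.rfl HDiff) m m' s M L e p ℓ₁ ℓ₂ a lo hi hbd hdom hint

/-- **`stub_rebaseSimpleZeroTwo` conditionally on the NARROW different-slope hypothesis `HDiff`**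
(line `janus-bands`). Elements of `GS 0 2` (one base coordinate `y` in a bounded rational cell,
base factor `p/∏ Lⱼ^{eⱼ} · (y − ℓ₁)^{n₁}/(y − ℓ₂)` with `n₁ = 0`, two fibres `t₀, t₁` with
optional letters `1/(tᵢ − cᵢ(y))`, bounds affine in `y` or mutual) are congruent modulo
`KZ.relations` to `ℤ`-combinations of elements of `GG 0 2 2 ∪ JJ 0 3 ∪ JD 2` — in fact of
`GG 0 2 2` (constant letters, bounds constant or exactly `y`) — PROVIDED every clean nest
`A(y) < tᵢ < tⱼ < B(y)` both of whose fibres carry letters of DIFFERENT `y`-slopes is good for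
`GG 0 2 2` (`HDiff`, worker W8: edge expansion + frame change of variables). Proof: unpack the
literal datum; product fibres by `RebaseZero.good_literal` (worker W2), nested pairs by the
normalisation of the linking patterns (`rebaseSimpleZeroTwo_of_clean`) down to clean nests, which
are `rebaseSimpleZero_nestedCommonMain` (common slope, worker W3) or `HDiff`; finally
`GG 0 2 2 ⊆ GG 0 2 2 ∪ JJ 0 3 ∪ JD 2`. The defining equations of `JJ`, `JD` are not needed.
[Kontsevich–Zagier 2001, §1.2, rules (1a), (1b), (2)] -/
theorem rebaseSimpleZeroTwo_of_different' (GS : ℕ → ℕ → Set KZ.FormalRep) (GG : ℕ → ℕ → ℕ → Set KZ.FormalRep) (hGS : ∀ b k, GS b k = {w : KZ.FormalRep | ∃ (m m' n₁ n₂ : ℕ) (s : KZ.IntegralRep (b + 1 + k)) (M : Fin m' → (Fin (b + 1) → ℚ) × ℚ) (L : Fin m → (Fin b → ℚ) × ℚ) (e : Fin m → ℕ) (p : MvPolynomial (Fin b) ℚ) (ℓ₁ ℓ₂ : (Fin b → ℚ) × ℚ) (a : Fin k → Option ((Fin (b + 1) → ℚ) × ℚ)) (lo hi : Fin k → Fin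 k ⊕ ((Fin (b + 1) → ℚ) × ℚ)), (n₁ = 0 ∨ n₂ = 0) ∧ n₂ = 1 ∧ Bornology.IsBounded s.domain ∧ s.domain = {z | (∀ j, 0 < ∑ i, ((M j).1 i : ℝ) * z (Fin.castAdd k i) + ((M j).2 : ℝ)) ∧ ∀ i, Sum.elim (fun j => z (Fin.natAdd (b + 1) j)) (fun c => ∑ i', (c.1 i' : ℝ) * z (Fin.castAdd k i') + (c.2 : ℝ)) (lo i) < z (Fin.natAdd (b + 1) i) ∧ z (Fin.natAdd (b + 1) i) < Sum.elim (fun j => z (Fin.natAdd (b + 1) j)) (fun c => ∑ i', (c.1 i' : ℝ) * z (Fin.castAdd k i') + (c.2 : ℝ)) (hi i)} ∧ EqOn s.integrand (fun z => MvPolynomial.aeval (fun i => z (Fin.castAdd k (Fin.castSucc i))) p / (∏ j, (∑ i, ((L j).1 i : ℝ) * z (Fin.castAdd k (Fin.castSucc i)) + ((L j).2 : ℝ)) ^ e j) * ((z (Fin.castAdd k (Fin.last b)) - (∑ i, (ℓ₁.1 i : ℝ) * z (Fin.castAdd k (Fin.castSucc i)) + (ℓ₁.2 : ℝ))) ^ n₁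 / (z (Fin.castAdd k (Fin.last b)) - (∑ i, (ℓ₂.1 i : ℝ) * z (Fin.castAdd k (Fin.castSucc i)) + (ℓ₂.2 : ℝ))) ^ n₂) * ∏ i, (a i).elim 1 (fun c => 1 / (z (Fin.natAdd (b + 1) i) - (∑ i', (c.1 i' : ℝ) * z (Fin.castAdd k i') + (c.2 : ℝ))))) s.domain ∧ w = KZ.of s}) (hGG : ∀ b σ k, GG b σ k = {w : KZ.FormalRep | ∃ (m m' n₁ n₂ : ℕ) (s : KZ.IntegralRep (b + 1 + k)) (M : Fin m' → (Fin (b + 1) → ℚ) × ℚ) (L : Fin m → (Fin b → ℚ) × ℚ) (e : Fin m → ℕ) (p : MvPolynomial (Fin b) ℚ) (ℓ₁ ℓ₂ : (Fin b → ℚ) × ℚ) (a : Fin k → Option ((Fin (b + 1) → ℚ) × ℚ)) (lo hi : Fin k → Fin k ⊕ ((Fin (b + 1) → ℚ) × ℚ)), (n₁ = 0 ∨ n₂ = 0) ∧ (σ = 2 → (∀ i c, a i = some c → c.1 (Fin.last b) = 0) ∧ (∀ i c, (lo i = Sum.inr c ∨ hi i = Sum.inr c) → (c.1 (Fin.last b)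 = 0 ∨ c = (Pi.single (Fin.last b) 1, 0)))) ∧ Bornology.IsBounded s.domain ∧ s.domain = {z | (∀ j, 0 < ∑ i, ((M j).1 i : ℝ) * z (Fin.castAdd k i) + ((M j).2 : ℝ)) ∧ ∀ i, Sum.elim (fun j => z (Fin.natAdd (b + 1) j)) (fun c => ∑ i', (c.1 i' : ℝ) * z (Fin.castAdd k i') + (c.2 : ℝ)) (lo i) < z (Fin.natAdd (b + 1) i) ∧ z (Fin.natAdd (b + 1) i) < Sum.elim (fun j => z (Fin.natAdd (b + 1) j)) (fun c => ∑ i', (c.1 i' : ℝ) * z (Fin.castAdd k i') + (c.2 : ℝ)) (hi i)} ∧ EqOn s.integrand (fun z => MvPolynomial.aeval (fun i => z (Fin.castAdd k (Fin.castSucc i))) p / (∏ j, (∑ i, ((L j).1 i : ℝ) * z (Fin.castAdd k (Fin.castSucc i)) + ((L j).2 : ℝ)) ^ e j) * ((z (Fin.castAdd k (Fin.last b)) - (∑ i, (ℓ₁.1 i : ℝ) * z (Fin.castAdd k (Fin.castSucc i)) + (ℓ₁.2 : ℝ))) ^ n₁ / (z (Fin.castAdd k (Fin.last b)) - (∑ i,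 (ℓ₂.1 i : ℝ) * z (Fin.castAdd k (Fin.castSucc i)) + (ℓ₂.2 : ℝ))) ^ n₂) * ∏ i, (a i).elim 1 (fun c => 1 / (z (Fin.natAdd (b + 1) i) - (∑ i', (c.1 i' : ℝ) * z (Fin.castAdd k i') + (c.2 : ℝ))))) s.domain ∧ w = KZ.of s}) (JJ : ℕ → ℕ → Set KZ.FormalRep) (JD : ℕ → Set KZ.FormalRep) (hJJ : ∀ b k, JJ b k = {w : KZ.FormalRep | ∃ (m m' : ℕ) (s : KZ.IntegralRep (b + k)) (M : Fin m' → (Fin b → ℚ) × ℚ) (L : Fin m → (Fin b → ℚ) × ℚ) (e : Fin m → ℕ) (p : MvPolynomial (Fin b) ℚ) (a : Fin k → Option ((Fin b → ℚ) × ℚ)) (lo hi : Fin k → Fin k ⊕ ((Fin b → ℚ) × ℚ)), Bornology.IsBounded s.domain ∧ s.domain = {z | (∀ j, 0 < ∑ i, ((M j).1 i : ℝ) * z (Fin.castAdd k i) + ((M j).2 : ℝ)) ∧ ∀ i, Sum.elim (fun j => z (Fin.natAdd b j)) (fun c => ∑ i', (c.1 i' : ℝ) * z (Fin.castAdd k i')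 + (c.2 : ℝ)) (lo i) < z (Fin.natAdd b i) ∧ z (Fin.natAdd b i) < Sum.elim (fun j => z (Fin.natAdd b j)) (fun c => ∑ i', (c.1 i' : ℝ) * z (Fin.castAdd k i') + (c.2 : ℝ)) (hi i)} ∧ EqOn s.integrand (fun z => MvPolynomial.aeval (fun i => z (Fin.castAdd k i)) p / (∏ j, (∑ i, ((L j).1 i : ℝ) * z (Fin.castAdd k i) + ((L j).2 : ℝ)) ^ e j) * ∏ i, (a i).elim 1 (fun c => 1 / (z (Fin.natAdd b i) - (∑ i', (c.1 i' : ℝ) * z (Fin.castAdd k i') + (c.2 : ℝ))))) s.domain ∧ w = KZ.of s}) (hJD : ∀ N, JD N = {w : KZ.FormalRep | ∃ b' k', b' + k' = N ∧ w ∈ JJ b' k'}) (HDiff : ∀ (m m' : ℕ) (s : KZ.IntegralRep (0 + 1 + 2)) (M : Fin m' → (Fin (0 + 1) → ℚ) × ℚ) (L : Fin m → (Fin 0 → ℚ) × ℚ) (e : Fin m → ℕ) (p : MvPolynomial (Fin 0) ℚ) (ℓ₁ ℓ₂ : (Fin 0 → ℚ) × ℚ) (a : Fin 2 → Option ((Fin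 (0 + 1) → ℚ) × ℚ)) (lo hi : Fin 2 → Fin 2 ⊕ ((Fin (0 + 1) → ℚ) × ℚ)) (i j : Fin 2) (A B ci cj : (Fin (0 + 1) → ℚ) × ℚ), i ≠ j → lo i = Sum.inr A → hi i = Sum.inl j → lo j = Sum.inl i → hi j = Sum.inr B → a i = some ci → a j = some cj → ci.1 (Fin.last 0) ≠ cj.1 (Fin.last 0) → Bornology.IsBounded s.domain → s.domain = SeparatePos.gDom 0 2 m' M lo hi → EqOn s.integrand (RebasePos.glit 0 2 p L e ℓ₁ ℓ₂ 0 1 a) s.domain → ∃ c ∈ AddSubgroup.closure (SeparatePos.GGset 0 2 2), KZ.of s - c ∈ KZ.relations) : ∀ x ∈ GS 0 2, ∃ c ∈ AddSubgroup.closure (GG 0 2 2 ∪ JJ 0 3 ∪ JD 2), x - c ∈ KZ.relations := by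
  -- the defining equations of `JJ` and `JD` are part of the stub format but not needed here
  have _ := hJJ
  have _ := hJD
  intro x hx
  rw [hGS] at hx
  obtain ⟨m, m', n₁, n₂, s, M, L, e, p, ℓ₁, ℓ₂, a, lo, hi, h12, hn, hbd, hdom, hint, rfl⟩ := hx
  subst hn
  obtain rfl : n₁ = 0 := h12.resolve_right one_ne_zero
  have hsub : SeparatePos.GGset 0 2 2 ⊆ GG 0 2 2 ∪ JJ 0 3 ∪ JD 2 := fun w hw =>
    Or.inl (Or.inl (by rw [hGG]; exact hw))
  obtain ⟨c, hc, hxc⟩ := rebaseSimpleZeroTwo_of_clean (SeparatePos.GGset 0 2 2) Subset.rfl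
    (RebaseNest.clean_of_diff Subset.rfl HDiff) m m' s M L e p ℓ₁ ℓ₂ a lo hi hbd hdom hint
  exact ⟨c, AddSubgroup.closure_mono hsub hc, hxc⟩

/-- **`stub_rebaseSimpleZeroTwo` conditionally on the WIDE different-slope hypothesis `HDiff`**
(line `janus-bands`). As `rebaseSimpleZeroTwo_of_different'`, but the clean nests with letters of
different `y`-slopes are only assumed congruent to `ℤ`-combinations of elements of the stub's own
target `GG 0 2 2 ∪ JJ 0 3 ∪ JD 2` (WIDE `HDiff`): the reduction `rebaseSimpleZeroTwo_of_clean` is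
run directly with the target set `GG 0 2 2 ∪ JJ 0 3 ∪ JD 2 ⊇ GG 0 2 2` (product fibres and
common-slope clean nests land in `GG 0 2 2`, different-slope clean nests are `HDiff`). The
defining equations of `JJ`, `JD` are not needed. [Kontsevich–Zagier 2001, §1.2, rules (1a), (1b), (2)] -/
theorem rebaseSimpleZeroTwo_of_differentWide' (GS : ℕ → ℕ → Set KZ.FormalRep) (GG : ℕ → ℕ → ℕ → Set KZ.FormalRep) (hGS : ∀ b k, GS b k = {w : KZ.FormalRep | ∃ (m m' n₁ n₂ : ℕ) (s : KZ.IntegralRep (b + 1 + k)) (M : Fin m' → (Fin (b + 1) → ℚ) × ℚ) (L : Fin m → (Fin b → ℚ) × ℚ) (e : Fin m → ℕ) (p : MvPolynomial (Fin b) ℚ) (ℓ₁ ℓ₂ : (Fin b → ℚ) × ℚ) (a : Fin k → Option ((Fin (b + 1) → ℚ) × ℚ)) (lo hi : Fin k → Fin k ⊕ ((Fin (b + 1) → ℚ) × ℚ)), (n₁ = 0 ∨ n₂ = 0) ∧ n₂ = 1 ∧ Bornology.IsBounded s.domain ∧ s.domain = {z | (∀ j, 0 < ∑ i, ((M j).1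 i : ℝ) * z (Fin.castAdd k i) + ((M j).2 : ℝ)) ∧ ∀ i, Sum.elim (fun j => z (Fin.natAdd (b + 1) j)) (fun c => ∑ i', (c.1 i' : ℝ) * z (Fin.castAdd k i') + (c.2 : ℝ)) (lo i) < z (Fin.natAdd (b + 1) i) ∧ z (Fin.natAdd (b + 1) i) < Sum.elim (fun j => z (Fin.natAdd (b + 1) j)) (fun c => ∑ i', (c.1 i' : ℝ) * z (Fin.castAdd k i') + (c.2 : ℝ)) (hi i)} ∧ EqOn s.integrand (fun z => MvPolynomial.aeval (fun i => z (Fin.castAdd k (Fin.castSucc i))) p / (∏ j, (∑ i, ((L j).1 i : ℝ) * z (Fin.castAdd k (Fin.castSucc i)) + ((L j).2 : ℝ)) ^ e j) * ((z (Fin.castAdd k (Fin.last b)) - (∑ i, (ℓ₁.1 i : ℝ) * z (Fin.castAdd k (Fin.castSucc i)) + (ℓ₁.2 : ℝ))) ^ n₁ / (z (Fin.castAdd k (Fin.last b)) - (∑ i, (ℓ₂.1 i : ℝ) * z (Fin.castAdd k (Fin.castSucc i)) + (ℓ₂.2 : ℝ))) ^ n₂) * ∏ i, (a i).elim 1 (fun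 c => 1 / (z (Fin.natAdd (b + 1) i) - (∑ i', (c.1 i' : ℝ) * z (Fin.castAdd k i') + (c.2 : ℝ))))) s.domain ∧ w = KZ.of s}) (hGG : ∀ b σ k, GG b σ k = {w : KZ.FormalRep | ∃ (m m' n₁ n₂ : ℕ) (s : KZ.IntegralRep (b + 1 + k)) (M : Fin m' → (Fin (b + 1) → ℚ) × ℚ) (L : Fin m → (Fin b → ℚ) × ℚ) (e : Fin m → ℕ) (p : MvPolynomial (Fin b) ℚ) (ℓ₁ ℓ₂ : (Fin b → ℚ) × ℚ) (a : Fin k → Option ((Fin (b + 1) → ℚ) × ℚ)) (lo hi : Fin k → Fin k ⊕ ((Fin (b + 1) → ℚ) × ℚ)), (n₁ = 0 ∨ n₂ = 0) ∧ (σ = 2 → (∀ i c, a i = some c → c.1 (Fin.last b) = 0) ∧ (∀ i c, (lo i = Sum.inr c ∨ hi i = Sum.inr c) → (c.1 (Fin.last b) = 0 ∨ c = (Pi.single (Fin.last b) 1, 0)))) ∧ Bornology.IsBounded s.domain ∧ s.domain = {z | (∀ j, 0 < ∑ i, ((M j).1 i : ℝ) * z (Fin.castAdd k i) + ((M j).2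 : ℝ)) ∧ ∀ i, Sum.elim (fun j => z (Fin.natAdd (b + 1) j)) (fun c => ∑ i', (c.1 i' : ℝ) * z (Fin.castAdd k i') + (c.2 : ℝ)) (lo i) < z (Fin.natAdd (b + 1) i) ∧ z (Fin.natAdd (b + 1) i) < Sum.elim (fun j => z (Fin.natAdd (b + 1) j)) (fun c => ∑ i', (c.1 i' : ℝ) * z (Fin.castAdd k i') + (c.2 : ℝ)) (hi i)} ∧ EqOn s.integrand (fun z => MvPolynomial.aeval (fun i => z (Fin.castAdd k (Fin.castSucc i))) p / (∏ j, (∑ i, ((L j).1 i : ℝ) * z (Fin.castAdd k (Fin.castSucc i)) + ((L j).2 : ℝ)) ^ e j) * ((z (Fin.castAdd k (Fin.last b)) - (∑ i, (ℓ₁.1 i : ℝ) * z (Fin.castAdd k (Fin.castSucc i)) + (ℓ₁.2 : ℝ))) ^ n₁ / (z (Fin.castAdd k (Fin.last b)) - (∑ i, (ℓ₂.1 i : ℝ) * z (Fin.castAdd k (Fin.castSucc i)) + (ℓ₂.2 : ℝ))) ^ n₂) * ∏ i, (a i).elim 1 (fun c => 1 / (z (Fin.natAdd (b + 1) i) - (∑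 i', (c.1 i' : ℝ) * z (Fin.castAdd k i') + (c.2 : ℝ))))) s.domain ∧ w = KZ.of s}) (JJ : ℕ → ℕ → Set KZ.FormalRep) (JD : ℕ → Set KZ.FormalRep) (hJJ : ∀ b k, JJ b k = {w : KZ.FormalRep | ∃ (m m' : ℕ) (s : KZ.IntegralRep (b + k)) (M : Fin m' → (Fin b → ℚ) × ℚ) (L : Fin m → (Fin b → ℚ) × ℚ) (e : Fin m → ℕ) (p : MvPolynomial (Fin b) ℚ) (a : Fin k → Option ((Fin b → ℚ) × ℚ)) (lo hi : Fin k → Fin k ⊕ ((Fin b → ℚ) × ℚ)), Bornology.IsBounded s.domain ∧ s.domain = {z | (∀ j, 0 < ∑ i, ((M j).1 i : ℝ) * z (Fin.castAdd k i) + ((M j).2 : ℝ)) ∧ ∀ i, Sum.elim (fun j => z (Fin.natAdd b j)) (fun c => ∑ i', (c.1 i' : ℝ) * z (Fin.castAdd k i') + (c.2 : ℝ)) (lo i) < z (Fin.natAdd b i) ∧ z (Fin.natAdd b i) < Sum.elim (fun j => z (Fin.natAdd b j)) (fun c => ∑ i', (c.1 i' : ℝ) * z (Fin.castAdd k i') +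 (c.2 : ℝ)) (hi i)} ∧ EqOn s.integrand (fun z => MvPolynomial.aeval (fun i => z (Fin.castAdd k i)) p / (∏ j, (∑ i, ((L j).1 i : ℝ) * z (Fin.castAdd k i) + ((L j).2 : ℝ)) ^ e j) * ∏ i, (a i).elim 1 (fun c => 1 / (z (Fin.natAdd b i) - (∑ i', (c.1 i' : ℝ) * z (Fin.castAdd k i') + (c.2 : ℝ))))) s.domain ∧ w = KZ.of s}) (hJD : ∀ N, JD N = {w : KZ.FormalRep | ∃ b' k', b' + k' = N ∧ w ∈ JJ b' k'}) (HDiff : ∀ (m m' : ℕ) (s : KZ.IntegralRep (0 + 1 + 2)) (M : Fin m' → (Fin (0 + 1) → ℚ) × ℚ) (L : Fin m → (Fin 0 → ℚ) × ℚ) (e : Fin m → ℕ) (p : MvPolynomial (Fin 0) ℚ) (ℓ₁ ℓ₂ : (Fin 0 → ℚ) × ℚ) (a : Fin 2 → Option ((Fin (0 + 1) → ℚ) × ℚ)) (lo hi : Fin 2 → Fin 2 ⊕ ((Fin (0 + 1) → ℚ) × ℚ)) (i j : Fin 2) (A B ci cj : (Fin (0 + 1) → ℚ) × ℚ), i ≠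 j → lo i = Sum.inr A → hi i = Sum.inl j → lo j = Sum.inl i → hi j = Sum.inr B → a i = some ci → a j = some cj → ci.1 (Fin.last 0) ≠ cj.1 (Fin.last 0) → Bornology.IsBounded s.domain → s.domain = SeparatePos.gDom 0 2 m' M lo hi → EqOn s.integrand (RebasePos.glit 0 2 p L e ℓ₁ ℓ₂ 0 1 a) s.domain → ∃ c ∈ AddSubgroup.closure (GG 0 2 2 ∪ JJ 0 3 ∪ JD 2), KZ.of s - c ∈ KZ.relations) : ∀ x ∈ GS 0 2, ∃ c ∈ AddSubgroup.closure (GG 0 2 2 ∪ JJ 0 3 ∪ JD 2), x - c ∈ KZ.relations := by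
  -- the defining equations of `JJ` and `JD` are part of the stub format but not needed here
  have _ := hJJ
  have _ := hJD
  intro x hx
  rw [hGS] at hx
  obtain ⟨m, m', n₁, n₂, s, M, L, e, p, ℓ₁, ℓ₂, a, lo, hi, h12, hn, hbd, hdom, hint, rfl⟩ := hx
  subst hn
  obtain rfl : n₁ = 0 := h12.resolve_right one_ne_zero
  have hsub : SeparatePos.GGset 0 2 2 ⊆ GG 0 2 2 ∪ JJ 0 3 ∪ JD 2 := fun w hw =>
    Or.inl (Or.inl (by rw [hGG]; exact hw))
  exact rebaseSimpleZeroTwo_of_clean _ hsub (RebaseNest.clean_of_diff hsub HDiff) m m' s M L e p ℓ₁ ℓ₂ a lo hi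
    hbd hdom hint

end Summit.KontsevichZagierPeriods.ArrangementNormalForm.JanusBands
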